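import Summits.ValiantsHypothesis.ValiantsHypothesis.Theorems.SymPencilPerFourRowPairing
import Summits.ValiantsHypothesis.ValiantsHypothesis.Theorems.SymPencilPerFourCoordinateRadical

/-!
# Route `SymPencil` — a `2 × 3` block carries no per-base-point family with `< 6` squares
# (brick (B) of the `(10, 6)` cell of `Cruxes/SdcSuperquadratic/NEXT-RUNG-25.md`;
# `--supports` stmt-ValiantsHypothesis-5674 `SdcSuperquadratic`; rung currency only)

**Theorem** (`false_of_block_le_of_sqFamily`).  Over a field of characteristic `0`, if a linear
space `V` of `4 × 4` matrices CONTAINS a `2 × 3` block (all matrices supported in rows `p, q` and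
in the columns `≠ c₀`), then `V` carries no per-base-point family of `< 6` squares: there is a
base point `u` at which the `s²`-coefficient of `per_4 (u + s y)` (`y ∈ V`) is not of the form
`Σ_{k ∈ ι} c_k Λ_k(y)²`, `|ι| < 6`.

Proof (`false_of_block23_le_of_sqFamily`, rows `0, 1`, zero column `3`).  At `u = 𝟙` on the two
complementary rows the `s²`-coefficient is the row pairing of `SymPencilPerFourRowPairing`
(val-width-5674-p3) with `v = w = 𝟙`: on the block it is `2 (αᵀ (J - I) β)` for the two rows
`α, β ∈ K³` of `y`, a quadratic form of RANK `6` (`J - I` is invertible on `K³` in characteristic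
`0`); a sum of `< 6` squares restricted to the `6`-parameter block has a non-zero translation
vector, i.e. a radical vector of the form — contradiction.

Context: the `2 × 3` blocks are the `6`-dimensional singular subspaces on which `rank Hess per_4 ≤ 4`
(so the per-direction reading does NOT exclude them at defects `4, 5`); this per-base-point
reading does.  With brick (C) (`SymPencilPerFourSixDimCross`) and the detecting-pair brick (D) this
reduces the hypothesis `H106` of `SymPencilSdcPerFourTwentySixReduction` to the structural residual
«a `6`-dimensional singular subspace with the minors has a detecting pair or lies in a cross».
Honest framing: a lemma; `sdc(per_4) ≥ 25` is the tree's value; the crux `SdcSuperquadratic` and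
`VP ≠ VNP` are untouched.  No definitions, no named facts. [folklore]
-/

noncomputable section

-- single-conjunct layout: Sub = Summit, duplicated namespace component intended
set_option linter.dupNamespace false

namespace Summit.ValiantsHypothesis.ValiantsHypothesis.Theorems.SymPencilPerFourSixDimBlock

open Matrix MvPolynomial Finset Module
open Literature.Computability.AlgebraicComplexity
open Summit.ValiantsHypothesis.ValiantsHypothesis.Theorems.SymPencilPerFourBlocks
open Summit.ValiantsHypothesis.ValiantsHypothesis.Theorems.SymPencilPerFourHessianBlocks
open Summit.ValiantsHypothesis.ValiantsHypothesis.Theorems.SymPencilPerFourRowPairing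
open Summit.ValiantsHypothesis.ValiantsHypothesis.Theorems.SymPencilPerFourCoordinateRadical

variable {K : Type*} [Field K]

/-- **The `2 × 3` block on rows `0, 1`, columns `0, 1, 2`.**  If `V` contains it, no
per-base-point family with `|ι| < 6` squares exists on `V`. [folklore] -/
theorem false_of_block23_le_of_sqFamily [CharZero K] {ι : Type*} [Fintype ι]
    (hι : Fintype.card ι < 6) (V : Submodule K (Fin 4 × Fin 4 → K))
    (hV : ∀ x : Fin 4 × Fin 4 → K, (∀ i j : Fin 4, i ≠ 0 → i ≠ 1 → x (i, j) = 0) →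
      x (0, 3) = 0 → x (1, 3) = 0 → x ∈ V)
    (hfam : ∀ u : Fin 4 × Fin 4 → K, ∃ (c : ι → K) (Λ : ι → ((Fin 4 × Fin 4 → K) →ₗ[K] K)),
      ∀ y ∈ V, ∃ e₀ e₁ : K, ∀ s : K,
        eval (u + s • y) (perPoly (Fin 4) K) = e₀ + s * e₁ + s ^ 2 * ∑ k, c k * (Λ k y) ^ 2) :
    False := by
  classical
  -- the base point `𝟙` on rows `2, 3`
  obtain ⟨c, Λ, hcΛ⟩ := hfam (fun p : Fin 4 × Fin 4 =>
    if p.1 = 2 then (fun _ : Fin 4 => (1 : K)) p.2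
    else if p.1 = 3 then (fun _ : Fin 4 => (1 : K)) p.2 else 0)
  -- the block, parametrised by its two rows `α, β ∈ K³`
  let coeff : Fin 4 × Fin 4 → ((Fin 3 → K) × (Fin 3 → K) →ₗ[K] K) := fun p =>
    if p = (0, 0) then (LinearMap.proj 0).comp (LinearMap.fst K _ _)
    else if p = (0, 1) then (LinearMap.proj 1).comp (LinearMap.fst K _ _)
    else if p = (0, 2) then (LinearMap.proj 2).comp (LinearMap.fst K _ _)
    else if p = (1, 0) then (LinearMap.proj 0).comp (LinearMap.snd K _ _)
    else if p = (1, 1) then (LinearMap.proj 1).comp (LinearMap.snd K _ _)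
    else if p = (1, 2) then (LinearMap.proj 2).comp (LinearMap.snd K _ _) else 0
  let Ψ : (Fin 3 → K) × (Fin 3 → K) →ₗ[K] (Fin 4 × Fin 4 → K) := LinearMap.pi coeff
  have hΨ : ∀ α β : Fin 3 → K, Ψ (α, β) = fun p =>
      if p = (0, 0) then α 0 else if p = (0, 1) then α 1 else if p = (0, 2) then α 2
      else if p = (1, 0) then β 0 else if p = (1, 1) then β 1 else if p = (1, 2) then β 2
      else 0 := by
    intro α β
    ext p
    simp only [Ψ, LinearMap.pi_apply, coeff]
    split_ifs <;> rfl
  have hΨV : ∀ αβ : (Fin 3 → K) × (Fin 3 → K), Ψ αβ ∈ V := by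
    rintro ⟨α, β⟩
    refine hV _ (fun i j hi0 hi1 => ?_) ?_ ?_
    · rw [hΨ]
      have h0 : ((i, j) : Fin 4 × Fin 4) ≠ (0, 0) := fun h => hi0 (Prod.mk.inj h).1
      have h1 : ((i, j) : Fin 4 × Fin 4) ≠ (0, 1) := fun h => hi0 (Prod.mk.inj h).1
      have h2 : ((i, j) : Fin 4 × Fin 4) ≠ (0, 2) := fun h => hi0 (Prod.mk.inj h).1
      have h3 : ((i, j) : Fin 4 × Fin 4) ≠ (1, 0) := fun h => hi1 (Prod.mk.inj h).1
      have h4 : ((i, j) : Fin 4 × Fin 4) ≠ (1, 1) := fun h => hi1 (Prod.mk.inj h).1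
      have h5 : ((i, j) : Fin 4 × Fin 4) ≠ (1, 2) := fun h => hi1 (Prod.mk.inj h).1
      simp [h0, h1, h2, h3, h4, h5]
    · rw [hΨ]; simp
    · rw [hΨ]; simp
  -- the `s²`-coefficient on the block: `Q(α, β) = 2 (Σα Σβ - α·β)`
  set Q : (Fin 3 → K) → (Fin 3 → K) → K := fun α β =>
    2 * ((α 1 * β 2 + α 2 * β 1) + (α 0 * β 2 + α 2 * β 0) + (α 0 * β 1 + α 1 * β 0)) with hQ
  have hS : ∀ α β : Fin 3 → K, ∑ k, c k * (Λ k (Ψ (α, β))) ^ 2 = Q α β := by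
    intro α β
    obtain ⟨e₀, e₁, he⟩ := hcΛ (Ψ (α, β)) (hΨV (α, β))
    obtain ⟨c₃, c₄, hc⟩ := eval_perPoly_rowsTwoThree_add_smul (fun _ : Fin 4 => (1 : K))
      (fun _ : Fin 4 => (1 : K)) (Ψ (α, β))
    have hc' : ∀ s : K, eval ((fun p : Fin 4 × Fin 4 =>
        if p.1 = 2 then (fun _ : Fin 4 => (1 : K)) p.2
        else if p.1 = 3 then (fun _ : Fin 4 => (1 : K)) p.2 else 0) + s • Ψ (α, β))
        (perPoly (Fin 4) K) = s ^ 2 * Q α β + s ^ 3 * c₃ + s ^ 4 * c₄ := by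
      intro s
      rw [hc s, hΨ]
      simp only [hQ, Prod.mk.injEq,
        show ((1 : Fin 4) = 0) = False by decide, show ((2 : Fin 4) = 0) = False by decide,
        show ((3 : Fin 4) = 0) = False by decide, show ((0 : Fin 4) = 1) = False by decide,
        show ((2 : Fin 4) = 1) = False by decide, show ((3 : Fin 4) = 1) = False by decide,
        show ((0 : Fin 4) = 2) = False by decide, show ((1 : Fin 4) = 2) = False by decide,
        show ((3 : Fin 4) = 2) = False by decide,
        and_true, and_false, if_true, if_false, and_self]
      ring
    exact coeff_two_eq_of_forall fun s => by rw [← he s, hc' s]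
  -- a common-kernel vector of the `Λ_k ∘ Ψ` (six parameters, fewer than six functionals)
  let M : (Fin 3 → K) × (Fin 3 → K) →ₗ[K] (ι → K) := LinearMap.pi fun k => (Λ k).comp Ψ
  have hM : ∀ v k, M v k = Λ k (Ψ v) := fun v k => rfl
  have hker : LinearMap.ker M ≠ ⊥ := LinearMap.ker_ne_bot_of_finrank_lt (by
    rw [Module.finrank_fintype_fun_eq_card, Module.finrank_prod,
      Module.finrank_fintype_fun_eq_card, Fintype.card_fin]
    omega)
  obtain ⟨n, hn, hn0⟩ := Submodule.exists_mem_ne_zero_of_ne_bot hker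
  have hΛ0 : ∀ k, Λ k (Ψ n) = 0 := fun k => by
    have := congr_fun (LinearMap.mem_ker.1 hn) k
    rwa [hM] at this
  have hinv : ∀ α β : Fin 3 → K, Q (n.1 + α) (n.2 + β) = Q α β := by
    intro α β
    have h1 := hS (n.1 + α) (n.2 + β)
    have hadd : ((n.1 + α, n.2 + β) : (Fin 3 → K) × (Fin 3 → K)) = n + (α, β) := rfl
    rw [hadd, map_add] at h1
    simp only [map_add, hΛ0, zero_add] at h1
    rw [hS α β] at h1
    exact h1.symm
  -- polar identities against the unit vectors
  have hsingle : ∀ (i j : Fin 3), (Pi.single i (1 : K) : Fin 3 → K) j = if j = i then 1 else 0 :=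
    fun i j => by rw [Pi.single_apply]
  have E00 := hinv 0 0
  have Ea0 := hinv (Pi.single 0 1) 0
  have Ea1 := hinv (Pi.single 1 1) 0
  have Ea2 := hinv (Pi.single 2 1) 0
  have Eb0 := hinv 0 (Pi.single 0 1)
  have Eb1 := hinv 0 (Pi.single 1 1)
  have Eb2 := hinv 0 (Pi.single 2 1)
  simp only [hQ, Pi.add_apply, Pi.zero_apply, hsingle,
    show ((1 : Fin 3) = 0) = False by decide, show ((2 : Fin 3) = 0) = False by decide,
    show ((0 : Fin 3) = 1) = False by decide, show ((2 : Fin 3) = 1) = False by decide,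
    show ((0 : Fin 3) = 2) = False by decide, show ((1 : Fin 3) = 2) = False by decide,
    if_true, if_false, add_zero, mul_zero, mul_one] at E00 Ea0 Ea1 Ea2 Eb0 Eb1 Eb2
  -- `(J - I) β⁰ = 0` and `(J - I) α⁰ = 0`, hence `n = 0`
  have hb0 : n.2 0 = 0 := by linear_combination (-(Ea0 - E00) + (Ea1 - E00) + (Ea2 - E00)) / 4
  have hb1 : n.2 1 = 0 := by linear_combination ((Ea0 - E00) - (Ea1 - E00) + (Ea2 - E00)) / 4
  have hb2 : n.2 2 = 0 := by linear_combination ((Ea0 - E00) + (Ea1 - E00) - (Ea2 - E00)) / 4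
  have ha0 : n.1 0 = 0 := by linear_combination (-(Eb0 - E00) + (Eb1 - E00) + (Eb2 - E00)) / 4
  have ha1 : n.1 1 = 0 := by linear_combination ((Eb0 - E00) - (Eb1 - E00) + (Eb2 - E00)) / 4
  have ha2 : n.1 2 = 0 := by linear_combination ((Eb0 - E00) + (Eb1 - E00) - (Eb2 - E00)) / 4
  apply hn0
  ext i <;> fin_cases i
  · exact ha0
  · exact ha1
  · exact ha2
  · exact hb0
  · exact hb1
  · exact hb2

/-- **A `2 × 3` block in general position.**  If `V` contains all matrices supported in rows
`p ≠ q` and in the columns `≠ c₀`, then `V` carries no per-base-point family with `|ι| < 6`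
squares. [folklore] -/
theorem false_of_block_le_of_sqFamily [CharZero K] {ι : Type*} [Fintype ι]
    (hι : Fintype.card ι < 6) (V : Submodule K (Fin 4 × Fin 4 → K)) {p q : Fin 4} (hpq : p ≠ q)
    (c₀ : Fin 4)
    (hV : ∀ x : Fin 4 × Fin 4 → K, (∀ i j : Fin 4, i ≠ p → i ≠ q → x (i, j) = 0) →
      x (p, c₀) = 0 → x (q, c₀) = 0 → x ∈ V)
    (hfam : ∀ u : Fin 4 × Fin 4 → K, ∃ (c : ι → K) (Λ : ι → ((Fin 4 × Fin 4 → K) →ₗ[K] K)),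
      ∀ y ∈ V, ∃ e₀ e₁ : K, ∀ s : K,
        eval (u + s • y) (perPoly (Fin 4) K) = e₀ + s * e₁ + s ^ 2 * ∑ k, c k * (Λ k y) ^ 2) :
    False := by
  obtain ⟨σ, hσ0, hσ1⟩ := exists_perm_zero_one p q hpq
  set τ : Equiv.Perm (Fin 4) := Equiv.swap 3 c₀ with hτ
  set Φ : (Fin 4 × Fin 4 → K) ≃ₗ[K] (Fin 4 × Fin 4 → K) :=
    LinearEquiv.funCongrLeft K K (Equiv.prodCongr σ τ) with hΦ
  have hΦa : ∀ (x : Fin 4 × Fin 4 → K) (i j : Fin 4), Φ x (i, j) = x (σ i, τ j) := fun x i j => rfl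
  have hfam' := sqFamily_map V Φ (fun z => eval_perPoly_comp_prodCongr σ τ z) hfam
  set V' := V.map Φ.toLinearMap with hV'def
  refine false_of_block23_le_of_sqFamily hι V' (fun x hx h03 h13 => ?_) hfam'
  -- `x = Φ (Φ⁻¹ x)` with `Φ⁻¹ x` in the original block
  refine ⟨Φ.symm x, hV _ (fun i j hip hiq => ?_) ?_ ?_, by simp⟩
  · have h : Φ.symm x (i, j) = x (σ.symm i, τ.symm j) := by
      simp [hΦ, LinearEquiv.funCongrLeft_symm, Equiv.prodCongr_symm]
    rw [h]
    refine hx _ _ (fun h0 => hip ?_) (fun h1 => hiq ?_)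
    · rw [← hσ0, ← h0, Equiv.apply_symm_apply]
    · rw [← hσ1, ← h1, Equiv.apply_symm_apply]
  · have h : Φ.symm x (p, c₀) = x (σ.symm p, τ.symm c₀) := by
      simp [hΦ, LinearEquiv.funCongrLeft_symm, Equiv.prodCongr_symm]
    rw [h, ← hσ0, Equiv.symm_apply_apply, hτ, Equiv.symm_swap, Equiv.swap_apply_right]
    exact h03
  · have h : Φ.symm x (q, c₀) = x (σ.symm q, τ.symm c₀) := by
      simp [hΦ, LinearEquiv.funCongrLeft_symm, Equiv.prodCongr_symm]
    rw [h, ← hσ1, Equiv.symm_apply_apply, hτ, Equiv.symm_swap, Equiv.swap_apply_right]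
    exact h13

end Summit.ValiantsHypothesis.ValiantsHypothesis.Theorems.SymPencilPerFourSixDimBlock

end
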